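import Mathlib.NumberTheory.LSeries.HurwitzZetaValues
import Mathlib.LinearAlgebra.Dimension.Constructions
import Literature.NumberTheory.Transcendental.MultipleZetaValuesProofs
import Literature.NumberTheory.Transcendental.MultipleZetaHoffmanRelationProofs
import Literature.NumberTheory.Transcendental.MultipleZetaWeightFiveProofs
import HarnessLib

/-!
# Multiple zeta values of weight `6`: the double shuffle relations, `𝒵₆ = ℚ π⁶ + ℚ ζ(3)²`

Sibling proof file of `Literature.NumberTheory.Transcendental.MultipleZeta` /
`…MultipleZetaValues` (theorems only: no definition, no statement change, no named fact),
continuing `MultipleZetaWeightFiveProofs.lean` one weight up. In the decreasing convention of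
`multipleZeta`, the sixteen admissible indices of weight `6` are
`(6), (5,1), (4,2), (3,3), (2,4), (4,1,1), (3,2,1), (3,1,2), (2,3,1), (2,2,2), (2,1,3), (3,1,1,1),
(2,2,1,1), (2,1,2,1), (2,1,1,2), (2,1,1,1,1)` (`MZV.eq_of_isAdmissible_of_weight_eq_six`), and
this file evaluates all sixteen multiple zeta values as rational combinations of `π⁶` and
`ζ(3)²` — equivalently of the two **Hoffman elements** `ζ(2,2,2) = π⁶/5040` and
`ζ(3,3) = ζ(3)²/2 - π⁶/1890` — from relations available in the tree:

* Euler's `ζ(2) = π²/6`, `ζ(6) = π⁶/945` (Mathlib's `riemannZeta_two_mul_nat`, `B₆ = 1/42`), and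
  the weight-`4` evaluations `ζ(4) = π⁴/90`, `ζ(3,1) = π⁴/360`, `ζ(2,2) = π⁴/120`,
  `ζ(2,1,1) = π⁴/90` (`MultipleZetaDepthTwoProofs.lean`, `MultipleZetaHoffmanRelationProofs.lean`)
  and Euler's `ζ(2,1) = ζ(3)`;
* the seven harmonic (stuffle) products of weight `6` of admissible factors, `(2)∗(4)`, `(3)∗(3)`,
  `(2)∗(2,2)`, `(2)∗(3,1)`, `(3)∗(2,1)`, `(2)∗(2,1,1)`, `(2,1)∗(2,1)` (Hoffman 1997, Theorem 4.2:
  `multipleZeta_mul`);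
* the two shuffle products of single zeta values `ζ(2)ζ(4) = ζ(2,4) + 2ζ(3,3) + 4ζ(4,2) + 8ζ(5,1)`,
  `ζ(3)² = 2ζ(3,3) + 6ζ(4,2) + 12ζ(5,1)` (Euler's decomposition theorem, Eie 2013, Theorem 1.2.3:
  `MultipleZetaShuffleProofs.lean`);
* the six duality relations of weight `6` (`MultipleZetaDuality.lean`; Hoffman 1992, §5 p. 289).

These sixteen linear relations among the sixteen MZVs and the two products `π⁶`, `ζ(3)²` have
full rank, which gives the table `multipleZeta_five_one_eq`, …, e.g. `ζ(2,2,2) = π⁶/5040 = π⁶/7!`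
(Hoffman 1992; Chmutov–Duzhin–Mostovoy 2012, (10.17)), `ζ(3,3) = (ζ(3)² - ζ(6))/2`,
`ζ(4,2) = ζ(3)² - 4π⁶/2835`, `ζ(5,1) = π⁶/1260 - ζ(3)²/2`, `ζ(2,4) = 25π⁶/11340 - ζ(3)²`. Hence
`mzvSpace_six_eq_span : 𝒵₆ = ℚ π⁶ + ℚ ζ(3)²` (Chmutov–Duzhin–Mostovoy 2012, §10.2.6: up to weight
`12` every MZV is "a rational polynomial in `ζ(2), ζ(3), ζ(5), ζ(7), ζ(2,6), …`"; in weight `6` the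
monomials are `ζ(2)³` and `ζ(3)²`), `mzvSpace_six_eq_span_hoffman : 𝒵₆ = ℚ ζ(2,2,2) + ℚ ζ(3,3)`
(Hoffman's conjecture / Brown's theorem in weight `6`; Hoffman 1992, §5: "all instances of both
conjectures are true when `n = 6`"), and `finrank_mzvSpace_six_le : dim_ℚ 𝒵₆ ≤ 2 = d₆`
(the Goncharov–Terasoma bound in weight `6`; equality would be the irrationality of `ζ(3)²/π⁶`,
which is open).

## References

* M. E. Hoffman, *Multiple harmonic series*, Pacific J. Math. 152 (1992), 275–290, §5 pp. 288–289
  (all relations of weight `≤ 6`; `ζ({2}^n)` conjectured by Moen). [Hoffman1992]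
* M. E. Hoffman, *The algebra of multiple harmonic series*, J. Algebra 194 (1997), 477–495,
  Theorem 4.2. [Hoffman1997]
* M. Eie, *The Theory of Multiple Zeta Values with Applications in Combinatorics*, World
  Scientific (2013), Theorem 1.2.3 (Euler's decomposition theorem), §1.1
  (`ζ({2}^n) = π^{2n}/(2n+1)!`). [Eie2013]
* S. Chmutov, S. Duzhin, J. Mostovoy, *Introduction to Vassiliev Knot Invariants*, CUP (2012),
  §10.2.6 (eq. (10.17) `ζ(2,…,2) = π^{2m}/(2m+1)!`; generators up to weight `12`).
  [ChmutovDuzhinMostovoy2012]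
-/

noncomputable section

namespace Literature.NumberTheory.Transcendental

/-! ### `ζ(6) = π⁶/945` -/

/-- `B₅' = 0`. [folklore] -/
private lemma bernoulli'_five : bernoulli' 5 = 0 := by
  have h1 : Nat.choose 5 2 = 10 := by decide
  have h2 : Nat.choose 5 3 = 10 := by decide
  rw [bernoulli'_def]
  norm_num [Finset.sum_range_succ, Finset.sum_range_zero, h1, h2]

/-- `B₆' = 1/42`. [folklore] -/
private lemma bernoulli'_six : bernoulli' 6 = 1 / 42 := by
  have h1 : Nat.choose 6 2 = 15 := by decide
  have h2 : Nat.choose 6 3 = 20 := by decide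
  have h3 : Nat.choose 6 4 = 15 := by decide
  rw [bernoulli'_def]
  norm_num [Finset.sum_range_succ, Finset.sum_range_zero, h1, h2, h3, bernoulli'_five]

/-- `ζ(6) = π⁶/945` for the multiple zeta value of the index `(6)` (Euler; Mathlib's
`riemannZeta_two_mul_nat` with `B₆ = 1/42`, and `ofReal_multipleZeta_singleton_holds`).
[folklore] -/
theorem multipleZeta_six : multipleZeta [6] = Real.pi ^ 6 / 945 := by
  have hz : riemannZeta 6 = (Real.pi : ℂ) ^ 6 / 945 := by
    have h := riemannZeta_two_mul_nat (k := 3) (by norm_num)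
    have hb : bernoulli 6 = 1 / 42 := by
      rw [bernoulli_eq_bernoulli'_of_ne_one (by norm_num), bernoulli'_six]
    norm_num [hb, Nat.factorial] at h
    rw [h]
    ring
  have h := ofReal_multipleZeta_singleton_holds (k := 6) (by norm_num)
  rw [Nat.cast_ofNat, hz] at h
  exact_mod_cast h

/-! ### The harmonic (stuffle) products of weight `6` -/

/-- `ζ(2)ζ(4) = ζ(2,4) + ζ(4,2) + ζ(6)` — harmonic product `(2) ∗ (4)` (Hoffman 1997,
Theorem 4.2; Chmutov–Duzhin–Mostovoy 2012, (10.16)). [cite: Hoffman1997, Theorem 4.2] -/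
theorem multipleZeta_two_mul_four_stuffle :
    multipleZeta [2] * multipleZeta [4] = multipleZeta [2, 4] + multipleZeta [4, 2] + multipleZeta [6] := by
  rw [multipleZeta_mul (MZV.isAdmissible_singleton_of_two_le le_rfl)
    (MZV.isAdmissible_singleton_of_two_le (by norm_num)),
    show MZV.stuffle [2] [4] = [[2, 4], [4, 2], [6]] by simp [MZV.stuffle]]
  simp only [List.map_cons, List.map_nil, List.sum_cons, List.sum_nil]
  ring

/-- `ζ(3)ζ(3) = 2ζ(3,3) + ζ(6)` — harmonic product `(3) ∗ (3)` (Hoffman 1997, Theorem 4.2).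
[cite: Hoffman1997, Theorem 4.2] -/
theorem multipleZeta_three_mul_three_stuffle :
    multipleZeta [3] * multipleZeta [3] = 2 * multipleZeta [3, 3] + multipleZeta [6] := by
  rw [multipleZeta_mul (MZV.isAdmissible_singleton_of_two_le (by norm_num))
    (MZV.isAdmissible_singleton_of_two_le (by norm_num)),
    show MZV.stuffle [3] [3] = [[3, 3], [3, 3], [6]] by simp [MZV.stuffle]]
  simp only [List.map_cons, List.map_nil, List.sum_cons, List.sum_nil]
  ring

/-- `ζ(2)ζ(2,2) = 3ζ(2,2,2) + ζ(2,4) + ζ(4,2)` — harmonic product `(2) ∗ (2,2)` (Hoffman 1997,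
Theorem 4.2). [cite: Hoffman1997, Theorem 4.2] -/
theorem multipleZeta_two_mul_two_two_stuffle :
    multipleZeta [2] * multipleZeta [2, 2] =
      3 * multipleZeta [2, 2, 2] + multipleZeta [2, 4] + multipleZeta [4, 2] := by
  rw [multipleZeta_mul (MZV.isAdmissible_singleton_of_two_le le_rfl)
    (MZV.isAdmissible_pair le_rfl (by norm_num)),
    show MZV.stuffle [2] [2, 2] = [[2, 2, 2], [2, 2, 2], [2, 2, 2], [2, 4], [4, 2]] by simp [MZV.stuffle]]
  simp only [List.map_cons, List.map_nil, List.sum_cons, List.sum_nil]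
  ring

/-- `ζ(2)ζ(3,1) = ζ(2,3,1) + ζ(3,2,1) + ζ(3,1,2) + ζ(3,3) + ζ(5,1)` — harmonic product
`(2) ∗ (3,1)` (Hoffman 1997, Theorem 4.2). [cite: Hoffman1997, Theorem 4.2] -/
theorem multipleZeta_two_mul_three_one_stuffle :
    multipleZeta [2] * multipleZeta [3, 1] =
      multipleZeta [2, 3, 1] + multipleZeta [3, 2, 1] + multipleZeta [3, 1, 2] + multipleZeta [3, 3] +
        multipleZeta [5, 1] := by
  rw [multipleZeta_mul (MZV.isAdmissible_singleton_of_two_le le_rfl)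
    (MZV.isAdmissible_pair (by norm_num) le_rfl),
    show MZV.stuffle [2] [3, 1] = [[2, 3, 1], [3, 2, 1], [3, 1, 2], [3, 3], [5, 1]] by simp [MZV.stuffle]]
  simp only [List.map_cons, List.map_nil, List.sum_cons, List.sum_nil]
  ring

/-- `ζ(3)ζ(2,1) = ζ(3,2,1) + ζ(2,3,1) + ζ(2,1,3) + ζ(2,4) + ζ(5,1)` — harmonic product
`(3) ∗ (2,1)` (Hoffman 1997, Theorem 4.2). [cite: Hoffman1997, Theorem 4.2] -/
theorem multipleZeta_three_mul_two_one_stuffle :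
    multipleZeta [3] * multipleZeta [2, 1] =
      multipleZeta [3, 2, 1] + multipleZeta [2, 3, 1] + multipleZeta [2, 1, 3] + multipleZeta [2, 4] +
        multipleZeta [5, 1] := by
  rw [multipleZeta_mul (MZV.isAdmissible_singleton_of_two_le (by norm_num))
    (MZV.isAdmissible_pair le_rfl le_rfl),
    show MZV.stuffle [3] [2, 1] = [[3, 2, 1], [2, 3, 1], [2, 1, 3], [2, 4], [5, 1]] by simp [MZV.stuffle]]
  simp only [List.map_cons, List.map_nil, List.sum_cons, List.sum_nil]
  ring

/-- `ζ(2)ζ(2,1,1) = 2ζ(2,2,1,1) + ζ(2,1,2,1) + ζ(2,1,1,2) + ζ(2,1,3) + ζ(2,3,1) + ζ(4,1,1)` —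
harmonic product `(2) ∗ (2,1,1)` (Hoffman 1997, Theorem 4.2). [cite: Hoffman1997, Theorem 4.2] -/
theorem multipleZeta_two_mul_two_one_one_stuffle :
    multipleZeta [2] * multipleZeta [2, 1, 1] =
      2 * multipleZeta [2, 2, 1, 1] + multipleZeta [2, 1, 2, 1] + multipleZeta [2, 1, 1, 2] +
        multipleZeta [2, 1, 3] + multipleZeta [2, 3, 1] + multipleZeta [4, 1, 1] := by
  rw [multipleZeta_mul (MZV.isAdmissible_singleton_of_two_le le_rfl)
    (by decide),
    show MZV.stuffle [2] [2, 1, 1] =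
      [[2, 2, 1, 1], [2, 2, 1, 1], [2, 1, 2, 1], [2, 1, 1, 2], [2, 1, 3], [2, 3, 1], [4, 1, 1]] by simp [MZV.stuffle]]
  simp only [List.map_cons, List.map_nil, List.sum_cons, List.sum_nil]
  ring

/-- `ζ(2,1)² = 2ζ(2,1,2,1) + 4ζ(2,2,1,1) + 2ζ(2,2,2) + 2ζ(2,3,1) + 2ζ(4,1,1) + ζ(4,2)` —
harmonic product `(2,1) ∗ (2,1)` (Hoffman 1997, Theorem 4.2). [cite: Hoffman1997, Theorem 4.2] -/
theorem multipleZeta_two_one_mul_two_one_stuffle :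
    multipleZeta [2, 1] * multipleZeta [2, 1] =
      2 * multipleZeta [2, 1, 2, 1] + 4 * multipleZeta [2, 2, 1, 1] + 2 * multipleZeta [2, 2, 2] +
        2 * multipleZeta [2, 3, 1] + 2 * multipleZeta [4, 1, 1] + multipleZeta [4, 2] := by
  rw [multipleZeta_mul (MZV.isAdmissible_pair le_rfl le_rfl) (MZV.isAdmissible_pair le_rfl le_rfl),
    show MZV.stuffle [2, 1] [2, 1] =
      [[2, 1, 2, 1], [2, 2, 1, 1], [2, 2, 1, 1], [2, 2, 2], [2, 3, 1],
        [2, 2, 1, 1], [2, 2, 1, 1], [2, 2, 2], [2, 1, 2, 1], [2, 3, 1],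
        [4, 1, 1], [4, 1, 1], [4, 2]] by simp [MZV.stuffle]]
  simp only [List.map_cons, List.map_nil, List.sum_cons, List.sum_nil]
  ring


/-! ### The relations with the products evaluated -/

/-- `(2) ∗ (4)` with `ζ(2)ζ(4) = π⁶/540`: `ζ(2,4) + ζ(4,2) + ζ(6) = π⁶/540`. [folklore] -/
theorem multipleZeta_stuffle_two_four_pi :
    multipleZeta [2, 4] + multipleZeta [4, 2] + multipleZeta [6] = Real.pi ^ 6 / 540 := by
  rw [← multipleZeta_two_mul_four_stuffle, multipleZeta_two, multipleZeta_four]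
  ring

/-- `(2) ∗ (2,2)` with `ζ(2)ζ(2,2) = π⁶/720`: `3ζ(2,2,2) + ζ(2,4) + ζ(4,2) = π⁶/720`. [folklore] -/
theorem multipleZeta_stuffle_two_two_two_pi :
    3 * multipleZeta [2, 2, 2] + multipleZeta [2, 4] + multipleZeta [4, 2] = Real.pi ^ 6 / 720 := by
  rw [← multipleZeta_two_mul_two_two_stuffle, multipleZeta_two, multipleZeta_two_two]
  ring

/-- `(2) ∗ (3,1)` with `ζ(2)ζ(3,1) = π⁶/2160`:
`ζ(2,3,1) + ζ(3,2,1) + ζ(3,1,2) + ζ(3,3) + ζ(5,1) = π⁶/2160`. [folklore] -/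
theorem multipleZeta_stuffle_two_three_one_pi :
    multipleZeta [2, 3, 1] + multipleZeta [3, 2, 1] + multipleZeta [3, 1, 2] + multipleZeta [3, 3] +
      multipleZeta [5, 1] = Real.pi ^ 6 / 2160 := by
  rw [← multipleZeta_two_mul_three_one_stuffle, multipleZeta_two, multipleZeta_three_one]
  ring

/-- `(3) ∗ (2,1)` with Euler's `ζ(2,1) = ζ(3)`:
`ζ(3)² = ζ(3,2,1) + ζ(2,3,1) + ζ(2,1,3) + ζ(2,4) + ζ(5,1)`. [folklore] -/
theorem multipleZeta_stuffle_three_two_one :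
    multipleZeta [3] * multipleZeta [3] =
      multipleZeta [3, 2, 1] + multipleZeta [2, 3, 1] + multipleZeta [2, 1, 3] + multipleZeta [2, 4] +
        multipleZeta [5, 1] := by
  have h := multipleZeta_three_mul_two_one_stuffle
  rw [show multipleZeta [2, 1] = multipleZeta [3] from euler_zeta_two_one_holds] at h
  exact h

/-- `(2) ∗ (2,1,1)` with `ζ(2)ζ(2,1,1) = π⁶/540`:
`2ζ(2,2,1,1) + ζ(2,1,2,1) + ζ(2,1,1,2) + ζ(2,1,3) + ζ(2,3,1) + ζ(4,1,1) = π⁶/540`. [folklore] -/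
theorem multipleZeta_stuffle_two_two_one_one_pi :
    2 * multipleZeta [2, 2, 1, 1] + multipleZeta [2, 1, 2, 1] + multipleZeta [2, 1, 1, 2] +
      multipleZeta [2, 1, 3] + multipleZeta [2, 3, 1] + multipleZeta [4, 1, 1] = Real.pi ^ 6 / 540 := by
  rw [← multipleZeta_two_mul_two_one_one_stuffle, multipleZeta_two, multipleZeta_two_one_one]
  ring

/-- `(2,1) ∗ (2,1)` with Euler's `ζ(2,1) = ζ(3)`:
`ζ(3)² = 2ζ(2,1,2,1) + 4ζ(2,2,1,1) + 2ζ(2,2,2) + 2ζ(2,3,1) + 2ζ(4,1,1) + ζ(4,2)`. [folklore] -/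
theorem multipleZeta_stuffle_two_one_two_one :
    multipleZeta [3] * multipleZeta [3] =
      2 * multipleZeta [2, 1, 2, 1] + 4 * multipleZeta [2, 2, 1, 1] + 2 * multipleZeta [2, 2, 2] +
        2 * multipleZeta [2, 3, 1] + 2 * multipleZeta [4, 1, 1] + multipleZeta [4, 2] := by
  have h := multipleZeta_two_one_mul_two_one_stuffle
  rw [show multipleZeta [2, 1] = multipleZeta [3] from euler_zeta_two_one_holds] at h
  exact h

/-- The shuffle `ζ(2)ζ(4)` with `ζ(2)ζ(4) = π⁶/540`:
`ζ(2,4) + 2ζ(3,3) + 4ζ(4,2) + 8ζ(5,1) = π⁶/540`. [folklore] -/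
theorem multipleZeta_shuffle_two_four_pi :
    multipleZeta [2, 4] + 2 * multipleZeta [3, 3] + 4 * multipleZeta [4, 2] +
      8 * multipleZeta [5, 1] = Real.pi ^ 6 / 540 := by
  rw [← multipleZeta_two_mul_four_shuffle, multipleZeta_two, multipleZeta_four]
  ring

/-! ### The sixteen multiple zeta values of weight `6` in terms of `π⁶` and `ζ(3)²`

Each evaluation below is a linear consequence of the sixteen relations listed in the module
docstring (the products being `ζ(2)ζ(4) = ζ(2)ζ(2,1,1) = π⁶/540`, `ζ(2)ζ(2,2) = π⁶/720`,
`ζ(2)ζ(3,1) = π⁶/2160`, `ζ(3)ζ(2,1) = ζ(2,1)² = ζ(3)²`), found by `linarith`. -/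

/-- `ζ(5,1) = π⁶/1260 - ζ(3)²/2`, i.e. Euler's `ζ(5,1) = (3/4)ζ(6) - ζ(3)²/2` (Eie 2013, §0.1:
`S_{1,5} = (7/2)ζ(6) - ζ(2)ζ(4) - ζ(3)²/2` with `S_{1,5} = ζ(5,1) + ζ(6)`, `ζ(2)ζ(4) = (7/4)ζ(6)`).
[cite: Eie2013, §0.1] -/
theorem multipleZeta_five_one_eq :
    multipleZeta [5, 1] = -(1 / 2 * multipleZeta [3] ^ 2) + 1 / 1260 * Real.pi ^ 6 := by
  have R0 := multipleZeta_six
  have R1 := multipleZeta_stuffle_two_four_pi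
  have R2 := multipleZeta_three_mul_three_stuffle
  have R3 := multipleZeta_stuffle_two_two_two_pi
  have R4 := multipleZeta_stuffle_two_three_one_pi
  have R5 := multipleZeta_stuffle_three_two_one
  have R6 := multipleZeta_stuffle_two_two_one_one_pi
  have R7 := multipleZeta_stuffle_two_one_two_one
  have R8 := multipleZeta_shuffle_two_four_pi
  have R9 := multipleZeta_three_mul_three_shuffle
  have D6 := multipleZeta_three_one_two_eq_two_three_one
  have D3 := multipleZeta_two_two_one_one_eq_four_two
  have D4 := multipleZeta_two_one_two_one_eq_three_three
  have D5 := multipleZeta_two_one_one_two_eq_two_four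
  rw [sq]
  linarith

/-- `ζ(4,2) = ζ(3)² - 4π⁶/2835 = ζ(3)² - (4/3)ζ(6)` (the double shuffle relations of weight `6`).
[cite: Hoffman1992, §5 p. 289] -/
theorem multipleZeta_four_two_eq :
    multipleZeta [4, 2] = multipleZeta [3] ^ 2 - 4 / 2835 * Real.pi ^ 6 := by
  have R0 := multipleZeta_six
  have R1 := multipleZeta_stuffle_two_four_pi
  have R2 := multipleZeta_three_mul_three_stuffle
  have R3 := multipleZeta_stuffle_two_two_two_pi
  have R4 := multipleZeta_stuffle_two_three_one_pi
  have R5 := multipleZeta_stuffle_three_two_one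
  have R6 := multipleZeta_stuffle_two_two_one_one_pi
  have R7 := multipleZeta_stuffle_two_one_two_one
  have R8 := multipleZeta_shuffle_two_four_pi
  have R9 := multipleZeta_three_mul_three_shuffle
  have D6 := multipleZeta_three_one_two_eq_two_three_one
  have D3 := multipleZeta_two_two_one_one_eq_four_two
  have D4 := multipleZeta_two_one_two_one_eq_three_three
  have D5 := multipleZeta_two_one_one_two_eq_two_four
  rw [sq]
  linarith

/-- `ζ(3,3) = ζ(3)²/2 - π⁶/1890 = (ζ(3)² - ζ(6))/2` (the harmonic product `(3) ∗ (3)`).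
[cite: Hoffman1997, Theorem 4.2] -/
theorem multipleZeta_three_three_eq :
    multipleZeta [3, 3] = 1 / 2 * multipleZeta [3] ^ 2 - 1 / 1890 * Real.pi ^ 6 := by
  have R0 := multipleZeta_six
  have R1 := multipleZeta_stuffle_two_four_pi
  have R2 := multipleZeta_three_mul_three_stuffle
  have R3 := multipleZeta_stuffle_two_two_two_pi
  have R4 := multipleZeta_stuffle_two_three_one_pi
  have R5 := multipleZeta_stuffle_three_two_one
  have R6 := multipleZeta_stuffle_two_two_one_one_pi
  have R7 := multipleZeta_stuffle_two_one_two_one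
  have R8 := multipleZeta_shuffle_two_four_pi
  have R9 := multipleZeta_three_mul_three_shuffle
  have D6 := multipleZeta_three_one_two_eq_two_three_one
  have D3 := multipleZeta_two_two_one_one_eq_four_two
  have D4 := multipleZeta_two_one_two_one_eq_three_three
  have D5 := multipleZeta_two_one_one_two_eq_two_four
  rw [sq]
  linarith

/-- `ζ(2,4) = 25π⁶/11340 - ζ(3)² = (25/12)ζ(6) - ζ(3)²` (the double shuffle relations of weight `6`).
[cite: Hoffman1992, §5 p. 289] -/
theorem multipleZeta_two_four_eq :
    multipleZeta [2, 4] = -(multipleZeta [3] ^ 2) + 5 / 2268 * Real.pi ^ 6 := by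
  have R0 := multipleZeta_six
  have R1 := multipleZeta_stuffle_two_four_pi
  have R2 := multipleZeta_three_mul_three_stuffle
  have R3 := multipleZeta_stuffle_two_two_two_pi
  have R4 := multipleZeta_stuffle_two_three_one_pi
  have R5 := multipleZeta_stuffle_three_two_one
  have R6 := multipleZeta_stuffle_two_two_one_one_pi
  have R7 := multipleZeta_stuffle_two_one_two_one
  have R8 := multipleZeta_shuffle_two_four_pi
  have R9 := multipleZeta_three_mul_three_shuffle
  have D6 := multipleZeta_three_one_two_eq_two_three_one
  have D3 := multipleZeta_two_two_one_one_eq_four_two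
  have D4 := multipleZeta_two_one_two_one_eq_three_three
  have D5 := multipleZeta_two_one_one_two_eq_two_four
  rw [sq]
  linarith

/-- `ζ(4,1,1) = -(ζ(3)²) + 23 / 15120 * π⁶` (the double shuffle and duality relations of weight `6`; Hoffman 1992,
§5 p. 289: for `n = 6` "all instances of both conjectures are true"). [cite: Hoffman1992, §5 p. 289] -/
theorem multipleZeta_four_one_one_eq :
    multipleZeta [4, 1, 1] = -(multipleZeta [3] ^ 2) + 23 / 15120 * Real.pi ^ 6 := by
  have R0 := multipleZeta_six
  have R1 := multipleZeta_stuffle_two_four_pi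
  have R2 := multipleZeta_three_mul_three_stuffle
  have R3 := multipleZeta_stuffle_two_two_two_pi
  have R4 := multipleZeta_stuffle_two_three_one_pi
  have R5 := multipleZeta_stuffle_three_two_one
  have R6 := multipleZeta_stuffle_two_two_one_one_pi
  have R7 := multipleZeta_stuffle_two_one_two_one
  have R8 := multipleZeta_shuffle_two_four_pi
  have R9 := multipleZeta_three_mul_three_shuffle
  have D6 := multipleZeta_three_one_two_eq_two_three_one
  have D3 := multipleZeta_two_two_one_one_eq_four_two
  have D4 := multipleZeta_two_one_two_one_eq_three_three
  have D5 := multipleZeta_two_one_one_two_eq_two_four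
  rw [sq]
  linarith

/-- `ζ(3,2,1) = 3 * ζ(3)² - 29 / 6480 * π⁶` (the double shuffle and duality relations of weight `6`; Hoffman 1992,
§5 p. 289: for `n = 6` "all instances of both conjectures are true"). [cite: Hoffman1992, §5 p. 289] -/
theorem multipleZeta_three_two_one_eq :
    multipleZeta [3, 2, 1] = 3 * multipleZeta [3] ^ 2 - 29 / 6480 * Real.pi ^ 6 := by
  have R0 := multipleZeta_six
  have R1 := multipleZeta_stuffle_two_four_pi
  have R2 := multipleZeta_three_mul_three_stuffle
  have R3 := multipleZeta_stuffle_two_two_two_pi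
  have R4 := multipleZeta_stuffle_two_three_one_pi
  have R5 := multipleZeta_stuffle_three_two_one
  have R6 := multipleZeta_stuffle_two_two_one_one_pi
  have R7 := multipleZeta_stuffle_two_one_two_one
  have R8 := multipleZeta_shuffle_two_four_pi
  have R9 := multipleZeta_three_mul_three_shuffle
  have D6 := multipleZeta_three_one_two_eq_two_three_one
  have D3 := multipleZeta_two_two_one_one_eq_four_two
  have D4 := multipleZeta_two_one_two_one_eq_three_three
  have D5 := multipleZeta_two_one_one_two_eq_two_four
  rw [sq]
  linarith

/-- `ζ(3,1,2) = -(3 / 2 * ζ(3)²) + 53 / 22680 * π⁶` (the double shuffle and duality relations of weight `6`; Hoffman 1992,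
§5 p. 289: for `n = 6` "all instances of both conjectures are true"). [cite: Hoffman1992, §5 p. 289] -/
theorem multipleZeta_three_one_two_eq :
    multipleZeta [3, 1, 2] = -(3 / 2 * multipleZeta [3] ^ 2) + 53 / 22680 * Real.pi ^ 6 := by
  have R0 := multipleZeta_six
  have R1 := multipleZeta_stuffle_two_four_pi
  have R2 := multipleZeta_three_mul_three_stuffle
  have R3 := multipleZeta_stuffle_two_two_two_pi
  have R4 := multipleZeta_stuffle_two_three_one_pi
  have R5 := multipleZeta_stuffle_three_two_one
  have R6 := multipleZeta_stuffle_two_two_one_one_pi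
  have R7 := multipleZeta_stuffle_two_one_two_one
  have R8 := multipleZeta_shuffle_two_four_pi
  have R9 := multipleZeta_three_mul_three_shuffle
  have D6 := multipleZeta_three_one_two_eq_two_three_one
  have D3 := multipleZeta_two_two_one_one_eq_four_two
  have D4 := multipleZeta_two_one_two_one_eq_three_three
  have D5 := multipleZeta_two_one_one_two_eq_two_four
  rw [sq]
  linarith

/-- `ζ(2,3,1) = -(3 / 2 * ζ(3)²) + 53 / 22680 * π⁶` (the double shuffle and duality relations of weight `6`; Hoffman 1992,
§5 p. 289: for `n = 6` "all instances of both conjectures are true"). [cite: Hoffman1992, §5 p. 289] -/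
theorem multipleZeta_two_three_one_eq :
    multipleZeta [2, 3, 1] = -(3 / 2 * multipleZeta [3] ^ 2) + 53 / 22680 * Real.pi ^ 6 := by
  have R0 := multipleZeta_six
  have R1 := multipleZeta_stuffle_two_four_pi
  have R2 := multipleZeta_three_mul_three_stuffle
  have R3 := multipleZeta_stuffle_two_two_two_pi
  have R4 := multipleZeta_stuffle_two_three_one_pi
  have R5 := multipleZeta_stuffle_three_two_one
  have R6 := multipleZeta_stuffle_two_two_one_one_pi
  have R7 := multipleZeta_stuffle_two_one_two_one
  have R8 := multipleZeta_shuffle_two_four_pi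
  have R9 := multipleZeta_three_mul_three_shuffle
  have D6 := multipleZeta_three_one_two_eq_two_three_one
  have D3 := multipleZeta_two_two_one_one_eq_four_two
  have D4 := multipleZeta_two_one_two_one_eq_three_three
  have D5 := multipleZeta_two_one_one_two_eq_two_four
  rw [sq]
  linarith

/-- **`ζ(2,2,2) = π⁶/5040 = π⁶/7!`** (Hoffman 1992, proving Moen's conjecture `ζ({2}^n) = π^{2n}/(2n+1)!`;
Chmutov–Duzhin–Mostovoy 2012, (10.17); Eie 2013, §1.1). Here from the double shuffle relations of
weight `6`. [cite: ChmutovDuzhinMostovoy2012, §10.2.6 eq. (10.17)] -/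
theorem multipleZeta_two_two_two_eq :
    multipleZeta [2, 2, 2] = 1 / 5040 * Real.pi ^ 6 := by
  have R0 := multipleZeta_six
  have R1 := multipleZeta_stuffle_two_four_pi
  have R2 := multipleZeta_three_mul_three_stuffle
  have R3 := multipleZeta_stuffle_two_two_two_pi
  have R4 := multipleZeta_stuffle_two_three_one_pi
  have R5 := multipleZeta_stuffle_three_two_one
  have R6 := multipleZeta_stuffle_two_two_one_one_pi
  have R7 := multipleZeta_stuffle_two_one_two_one
  have R8 := multipleZeta_shuffle_two_four_pi
  have R9 := multipleZeta_three_mul_three_shuffle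
  have D6 := multipleZeta_three_one_two_eq_two_three_one
  have D3 := multipleZeta_two_two_one_one_eq_four_two
  have D4 := multipleZeta_two_one_two_one_eq_three_three
  have D5 := multipleZeta_two_one_one_two_eq_two_four
  linarith

/-- `ζ(2,1,3) = ζ(3)² - 13 / 15120 * π⁶` (the double shuffle and duality relations of weight `6`; Hoffman 1992,
§5 p. 289: for `n = 6` "all instances of both conjectures are true"). [cite: Hoffman1992, §5 p. 289] -/
theorem multipleZeta_two_one_three_eq :
    multipleZeta [2, 1, 3] = multipleZeta [3] ^ 2 - 13 / 15120 * Real.pi ^ 6 := by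
  have R0 := multipleZeta_six
  have R1 := multipleZeta_stuffle_two_four_pi
  have R2 := multipleZeta_three_mul_three_stuffle
  have R3 := multipleZeta_stuffle_two_two_two_pi
  have R4 := multipleZeta_stuffle_two_three_one_pi
  have R5 := multipleZeta_stuffle_three_two_one
  have R6 := multipleZeta_stuffle_two_two_one_one_pi
  have R7 := multipleZeta_stuffle_two_one_two_one
  have R8 := multipleZeta_shuffle_two_four_pi
  have R9 := multipleZeta_three_mul_three_shuffle
  have D6 := multipleZeta_three_one_two_eq_two_three_one
  have D3 := multipleZeta_two_two_one_one_eq_four_two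
  have D4 := multipleZeta_two_one_two_one_eq_three_three
  have D5 := multipleZeta_two_one_one_two_eq_two_four
  rw [sq]
  linarith

/-- `ζ(3,1,1,1) = ζ(5,1) = -(1 / 2 * ζ(3)²) + 1 / 1260 * π⁶` (duality). [cite: Hoffman1992, §5 p. 289] -/
theorem multipleZeta_three_one_one_one_eq :
    multipleZeta [3, 1, 1, 1] = -(1 / 2 * multipleZeta [3] ^ 2) + 1 / 1260 * Real.pi ^ 6 := by
  rw [multipleZeta_three_one_one_one_eq_five_one]
  exact multipleZeta_five_one_eq

/-- `ζ(2,2,1,1) = ζ(4,2) = ζ(3)² - 4 / 2835 * π⁶` (duality). [cite: Hoffman1992, §5 p. 289] -/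
theorem multipleZeta_two_two_one_one_eq :
    multipleZeta [2, 2, 1, 1] = multipleZeta [3] ^ 2 - 4 / 2835 * Real.pi ^ 6 := by
  rw [multipleZeta_two_two_one_one_eq_four_two]
  exact multipleZeta_four_two_eq

/-- `ζ(2,1,2,1) = ζ(3,3) = 1 / 2 * ζ(3)² - 1 / 1890 * π⁶` (duality). [cite: Hoffman1992, §5 p. 289] -/
theorem multipleZeta_two_one_two_one_eq :
    multipleZeta [2, 1, 2, 1] = 1 / 2 * multipleZeta [3] ^ 2 - 1 / 1890 * Real.pi ^ 6 := by
  rw [multipleZeta_two_one_two_one_eq_three_three]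
  exact multipleZeta_three_three_eq

/-- `ζ(2,1,1,2) = ζ(2,4) = -(ζ(3)²) + 5 / 2268 * π⁶` (duality). [cite: Hoffman1992, §5 p. 289] -/
theorem multipleZeta_two_one_one_two_eq :
    multipleZeta [2, 1, 1, 2] = -(multipleZeta [3] ^ 2) + 5 / 2268 * Real.pi ^ 6 := by
  rw [multipleZeta_two_one_one_two_eq_two_four]
  exact multipleZeta_two_four_eq

/-- `ζ(2,1,1,1,1) = ζ(6) = 1 / 945 * π⁶` (duality). [cite: Hoffman1992, §5 p. 289] -/
theorem multipleZeta_two_one_one_one_one_eq :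
    multipleZeta [2, 1, 1, 1, 1] = 1 / 945 * Real.pi ^ 6 := by
  rw [multipleZeta_two_one_one_one_one_eq_six, multipleZeta_six]
  ring

/-! ### The admissible indices of weight `6` -/

/-- The admissible indices of weight `6` are `(6)`, `(5,1)`, `(4,2)`, `(3,3)`, `(2,4)`, `(4,1,1)`,
`(3,2,1)`, `(3,1,2)`, `(2,3,1)`, `(2,2,2)`, `(2,1,3)`, `(3,1,1,1)`, `(2,2,1,1)`, `(2,1,2,1)`,
`(2,1,1,2)` and `(2,1,1,1,1)`. [folklore] -/
theorem MZV.eq_of_isAdmissible_of_weight_eq_six {s : List ℕ} (hs : MZV.IsAdmissible s)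
    (hw : MZV.weight s = 6) :
    s = [6] ∨ s = [5, 1] ∨ s = [4, 2] ∨ s = [3, 3] ∨ s = [2, 4] ∨ s = [4, 1, 1] ∨ s = [3, 2, 1] ∨
      s = [3, 1, 2] ∨ s = [2, 3, 1] ∨ s = [2, 2, 2] ∨ s = [2, 1, 3] ∨ s = [3, 1, 1, 1] ∨
      s = [2, 2, 1, 1] ∨ s = [2, 1, 2, 1] ∨ s = [2, 1, 1, 2] ∨ s = [2, 1, 1, 1, 1] := by
  match s, hs, hw with
  | [], _, hw => simp [MZV.weight] at hw
  | [a], _, hw =>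
    simp only [MZV.weight, List.sum_cons, List.sum_nil, Nat.add_zero] at hw
    subst hw
    simp
  | [a, b], hs, hw =>
    have ha : 2 ≤ a := by simpa using hs.2 (by simp)
    have hb : 1 ≤ b := hs.1 b (by simp)
    simp only [MZV.weight, List.sum_cons, List.sum_nil, Nat.add_zero] at hw
    rcases (show (a = 5 ∧ b = 1) ∨ (a = 4 ∧ b = 2) ∨ (a = 3 ∧ b = 3) ∨ (a = 2 ∧ b = 4) by omega)
      with ⟨rfl, rfl⟩ | ⟨rfl, rfl⟩ | ⟨rfl, rfl⟩ | ⟨rfl, rfl⟩ <;> simp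
  | [a, b, c], hs, hw =>
    have ha : 2 ≤ a := by simpa using hs.2 (by simp)
    have hb : 1 ≤ b := hs.1 b (by simp)
    have hc : 1 ≤ c := hs.1 c (by simp)
    simp only [MZV.weight, List.sum_cons, List.sum_nil, Nat.add_zero] at hw
    rcases (show (a = 4 ∧ b = 1 ∧ c = 1) ∨ (a = 3 ∧ b = 2 ∧ c = 1) ∨ (a = 3 ∧ b = 1 ∧ c = 2) ∨
        (a = 2 ∧ b = 3 ∧ c = 1) ∨ (a = 2 ∧ b = 2 ∧ c = 2) ∨ (a = 2 ∧ b = 1 ∧ c = 3) by omega) with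
      ⟨rfl, rfl, rfl⟩ | ⟨rfl, rfl, rfl⟩ | ⟨rfl, rfl, rfl⟩ | ⟨rfl, rfl, rfl⟩ | ⟨rfl, rfl, rfl⟩ |
        ⟨rfl, rfl, rfl⟩ <;> simp
  | [a, b, c, d], hs, hw =>
    have ha : 2 ≤ a := by simpa using hs.2 (by simp)
    have hb : 1 ≤ b := hs.1 b (by simp)
    have hc : 1 ≤ c := hs.1 c (by simp)
    have hd : 1 ≤ d := hs.1 d (by simp)
    simp only [MZV.weight, List.sum_cons, List.sum_nil, Nat.add_zero] at hw
    rcases (show (a = 3 ∧ b = 1 ∧ c = 1 ∧ d = 1) ∨ (a = 2 ∧ b = 2 ∧ c = 1 ∧ d = 1) ∨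
        (a = 2 ∧ b = 1 ∧ c = 2 ∧ d = 1) ∨ (a = 2 ∧ b = 1 ∧ c = 1 ∧ d = 2) by omega) with
      ⟨rfl, rfl, rfl, rfl⟩ | ⟨rfl, rfl, rfl, rfl⟩ | ⟨rfl, rfl, rfl, rfl⟩ | ⟨rfl, rfl, rfl, rfl⟩ <;>
      simp
  | [a, b, c, d, e], hs, hw =>
    have ha : 2 ≤ a := by simpa using hs.2 (by simp)
    have hb : 1 ≤ b := hs.1 b (by simp)
    have hc : 1 ≤ c := hs.1 c (by simp)
    have hd : 1 ≤ d := hs.1 d (by simp)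
    have he : 1 ≤ e := hs.1 e (by simp)
    simp only [MZV.weight, List.sum_cons, List.sum_nil, Nat.add_zero] at hw
    obtain rfl : a = 2 := by omega
    obtain rfl : b = 1 := by omega
    obtain rfl : c = 1 := by omega
    obtain rfl : d = 1 := by omega
    obtain rfl : e = 1 := by omega
    simp
  | a :: b :: c :: d :: e :: f :: t, hs, hw =>
    exfalso
    have ha : 2 ≤ a := by simpa using hs.2 (by simp)
    have hb : 1 ≤ b := hs.1 b (by simp)
    have hc : 1 ≤ c := hs.1 c (by simp)
    have hd : 1 ≤ d := hs.1 d (by simp)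
    have he : 1 ≤ e := hs.1 e (by simp)
    have hf : 1 ≤ f := hs.1 f (by simp)
    simp only [MZV.weight, List.sum_cons] at hw
    omega

/-! ### The weight space `𝒵₆` -/

/-- Every multiple zeta value of weight `6` is a rational linear combination of `π⁶` and `ζ(3)²`
(Chmutov–Duzhin–Mostovoy 2012, §10.2.6; the table above). [cite: ChmutovDuzhinMostovoy2012, §10.2.6] -/
theorem multipleZeta_mem_span_of_weight_six {s : List ℕ} (hs : MZV.IsAdmissible s)
    (hw : MZV.weight s = 6) :
    multipleZeta s ∈ Submodule.span ℚ {Real.pi ^ 6, multipleZeta [3] ^ 2} := by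
  rcases MZV.eq_of_isAdmissible_of_weight_eq_six hs hw with
    rfl | rfl | rfl | rfl | rfl | rfl | rfl | rfl | rfl | rfl | rfl | rfl | rfl | rfl | rfl | rfl
  · exact mem_span_pair_of_eq_rat_mul_add (1 / 945) (0) (by rw [multipleZeta_six]; push_cast; ring)
  · exact mem_span_pair_of_eq_rat_mul_add (1 / 1260) (-1 / 2) (by rw [multipleZeta_five_one_eq]; push_cast; ring)
  · exact mem_span_pair_of_eq_rat_mul_add (-4 / 2835) (1) (by rw [multipleZeta_four_two_eq]; push_cast; ring)
  · exact mem_span_pair_of_eq_rat_mul_add (-1 / 1890) (1 / 2) (by rw [multipleZeta_three_three_eq]; push_cast; ring)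
  · exact mem_span_pair_of_eq_rat_mul_add (5 / 2268) (-1) (by rw [multipleZeta_two_four_eq]; push_cast; ring)
  · exact mem_span_pair_of_eq_rat_mul_add (23 / 15120) (-1) (by rw [multipleZeta_four_one_one_eq]; push_cast; ring)
  · exact mem_span_pair_of_eq_rat_mul_add (-29 / 6480) (3) (by rw [multipleZeta_three_two_one_eq]; push_cast; ring)
  · exact mem_span_pair_of_eq_rat_mul_add (53 / 22680) (-3 / 2) (by rw [multipleZeta_three_one_two_eq]; push_cast; ring)
  · exact mem_span_pair_of_eq_rat_mul_add (53 / 22680) (-3 / 2) (by rw [multipleZeta_two_three_one_eq]; push_cast; ring)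
  · exact mem_span_pair_of_eq_rat_mul_add (1 / 5040) (0) (by rw [multipleZeta_two_two_two_eq]; push_cast; ring)
  · exact mem_span_pair_of_eq_rat_mul_add (-13 / 15120) (1) (by rw [multipleZeta_two_one_three_eq]; push_cast; ring)
  · exact mem_span_pair_of_eq_rat_mul_add (1 / 1260) (-1 / 2) (by rw [multipleZeta_three_one_one_one_eq]; push_cast; ring)
  · exact mem_span_pair_of_eq_rat_mul_add (-4 / 2835) (1) (by rw [multipleZeta_two_two_one_one_eq]; push_cast; ring)
  · exact mem_span_pair_of_eq_rat_mul_add (-1 / 1890) (1 / 2) (by rw [multipleZeta_two_one_two_one_eq]; push_cast; ring)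
  · exact mem_span_pair_of_eq_rat_mul_add (5 / 2268) (-1) (by rw [multipleZeta_two_one_one_two_eq]; push_cast; ring)
  · exact mem_span_pair_of_eq_rat_mul_add (1 / 945) (0) (by rw [multipleZeta_two_one_one_one_one_eq]; push_cast; ring)

/-- **Hoffman's conjecture in weight `6`**: every multiple zeta value of weight `6` is a rational
linear combination of the Hoffman elements `ζ(2,2,2) = π⁶/5040` and `ζ(3,3) = ζ(3)²/2 - π⁶/1890`
(Hoffman 1992, §5: "all instances of both conjectures are true when `n = 6`"; Brown 2012,
Theorem 1.1 in weight `6`), e.g. `ζ(6) = (16/3)ζ(2,2,2)`, `ζ(2,1,3) = ζ(2,2,2) + 2ζ(3,3)`.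
[cite: Hoffman1992, §5 p. 289] -/
theorem multipleZeta_mem_span_hoffman_of_weight_six {s : List ℕ} (hs : MZV.IsAdmissible s)
    (hw : MZV.weight s = 6) :
    multipleZeta s ∈ Submodule.span ℚ {multipleZeta [2, 2, 2], multipleZeta [3, 3]} := by
  rcases MZV.eq_of_isAdmissible_of_weight_eq_six hs hw with
    rfl | rfl | rfl | rfl | rfl | rfl | rfl | rfl | rfl | rfl | rfl | rfl | rfl | rfl | rfl | rfl
  · exact mem_span_pair_of_eq_rat_mul_add (16 / 3) (0)
      (by rw [multipleZeta_six, multipleZeta_two_two_two_eq, multipleZeta_three_three_eq]; push_cast; ring)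
  · exact mem_span_pair_of_eq_rat_mul_add (4 / 3) (-1)
      (by rw [multipleZeta_five_one_eq, multipleZeta_two_two_two_eq, multipleZeta_three_three_eq]; push_cast; ring)
  · exact mem_span_pair_of_eq_rat_mul_add (-16 / 9) (2)
      (by rw [multipleZeta_four_two_eq, multipleZeta_two_two_two_eq, multipleZeta_three_three_eq]; push_cast; ring)
  · exact mem_span_pair_of_eq_rat_mul_add (0) (1)
      (by rw [multipleZeta_two_two_two_eq, multipleZeta_three_three_eq]; push_cast; ring)
  · exact mem_span_pair_of_eq_rat_mul_add (52 / 9) (-2)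
      (by rw [multipleZeta_two_four_eq, multipleZeta_two_two_two_eq, multipleZeta_three_three_eq]; push_cast; ring)
  · exact mem_span_pair_of_eq_rat_mul_add (7 / 3) (-2)
      (by rw [multipleZeta_four_one_one_eq, multipleZeta_two_two_two_eq, multipleZeta_three_three_eq]; push_cast; ring)
  · exact mem_span_pair_of_eq_rat_mul_add (-59 / 9) (6)
      (by rw [multipleZeta_three_two_one_eq, multipleZeta_two_two_two_eq, multipleZeta_three_three_eq]; push_cast; ring)
  · exact mem_span_pair_of_eq_rat_mul_add (34 / 9) (-3)
      (by rw [multipleZeta_three_one_two_eq, multipleZeta_two_two_two_eq, multipleZeta_three_three_eq]; push_cast; ring)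
  · exact mem_span_pair_of_eq_rat_mul_add (34 / 9) (-3)
      (by rw [multipleZeta_two_three_one_eq, multipleZeta_two_two_two_eq, multipleZeta_three_three_eq]; push_cast; ring)
  · exact mem_span_pair_of_eq_rat_mul_add (1) (0)
      (by rw [multipleZeta_two_two_two_eq, multipleZeta_three_three_eq]; push_cast; ring)
  · exact mem_span_pair_of_eq_rat_mul_add (1) (2)
      (by rw [multipleZeta_two_one_three_eq, multipleZeta_two_two_two_eq, multipleZeta_three_three_eq]; push_cast; ring)
  · exact mem_span_pair_of_eq_rat_mul_add (4 / 3) (-1)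
      (by rw [multipleZeta_three_one_one_one_eq, multipleZeta_two_two_two_eq, multipleZeta_three_three_eq]; push_cast; ring)
  · exact mem_span_pair_of_eq_rat_mul_add (-16 / 9) (2)
      (by rw [multipleZeta_two_two_one_one_eq, multipleZeta_two_two_two_eq, multipleZeta_three_three_eq]; push_cast; ring)
  · exact mem_span_pair_of_eq_rat_mul_add (0) (1)
      (by rw [multipleZeta_two_one_two_one_eq, multipleZeta_two_two_two_eq, multipleZeta_three_three_eq]; push_cast; ring)
  · exact mem_span_pair_of_eq_rat_mul_add (52 / 9) (-2)
      (by rw [multipleZeta_two_one_one_two_eq, multipleZeta_two_two_two_eq, multipleZeta_three_three_eq]; push_cast; ring)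
  · exact mem_span_pair_of_eq_rat_mul_add (16 / 3) (0)
      (by rw [multipleZeta_two_one_one_one_one_eq, multipleZeta_two_two_two_eq, multipleZeta_three_three_eq]; push_cast; ring)

/-- `π⁶ = 945 ζ(6) ∈ 𝒵₆`. [folklore] -/
theorem pi_pow_six_mem_mzvSpace_six : Real.pi ^ 6 ∈ mzvSpace 6 := by
  have h : Real.pi ^ 6 = (945 : ℚ) • multipleZeta [6] := by
    rw [multipleZeta_six, Rat.smul_def]; push_cast; ring
  rw [h]
  exact Submodule.smul_mem _ _ (Submodule.subset_span
    ⟨[6], MZV.isAdmissible_singleton_of_two_le (by norm_num), rfl, rfl⟩)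

/-- `ζ(3)² = 2ζ(3,3) + ζ(6) ∈ 𝒵₆` (an instance of `𝒵₃ · 𝒵₃ ⊆ 𝒵₆`). [cite: Hoffman1997, Theorem 4.2] -/
theorem multipleZeta_three_sq_mem_mzvSpace_six : multipleZeta [3] ^ 2 ∈ mzvSpace 6 := by
  rw [sq, multipleZeta_three_mul_three_stuffle, two_mul]
  have h33 : multipleZeta [3, 3] ∈ mzvSpace 6 :=
    Submodule.subset_span ⟨[3, 3], MZV.isAdmissible_pair (by norm_num) (by norm_num), rfl, rfl⟩
  refine Submodule.add_mem _ (Submodule.add_mem _ h33 h33) ?_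
  exact Submodule.subset_span ⟨[6], MZV.isAdmissible_singleton_of_two_le (by norm_num), rfl, rfl⟩

/-- **`𝒵₆ = ℚ π⁶ + ℚ ζ(3)²`** (Chmutov–Duzhin–Mostovoy 2012, §10.2.6: in weight `6` the monomials in
`ζ(2), ζ(3), ζ(5), …` are `ζ(2)³` and `ζ(3)²`). [cite: ChmutovDuzhinMostovoy2012, §10.2.6] -/
theorem mzvSpace_six_eq_span :
    mzvSpace 6 = Submodule.span ℚ {Real.pi ^ 6, multipleZeta [3] ^ 2} := by
  apply le_antisymm
  · rw [mzvSpace, Submodule.span_le]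
    rintro x ⟨s, hs, hw, rfl⟩
    exact multipleZeta_mem_span_of_weight_six hs hw
  · rw [Submodule.span_le]
    rintro x hx
    rcases hx with rfl | rfl
    · exact pi_pow_six_mem_mzvSpace_six
    · exact multipleZeta_three_sq_mem_mzvSpace_six

/-- **`𝒵₆ = ℚ ζ(2,2,2) + ℚ ζ(3,3)`**: the weight-`6` multiple zeta values span exactly the `ℚ`-span
of the two Hoffman elements of weight `6` (Hoffman's conjecture / Brown's theorem in weight `6`,
elementary there: Hoffman 1992, §5). [cite: Hoffman1992, §5 p. 289] -/
theorem mzvSpace_six_eq_span_hoffman :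
    mzvSpace 6 = Submodule.span ℚ {multipleZeta [2, 2, 2], multipleZeta [3, 3]} := by
  apply le_antisymm
  · rw [mzvSpace, Submodule.span_le]
    rintro x ⟨s, hs, hw, rfl⟩
    exact multipleZeta_mem_span_hoffman_of_weight_six hs hw
  · rw [Submodule.span_le]
    rintro x hx
    rcases hx with rfl | rfl
    · exact Submodule.subset_span ⟨[2, 2, 2], by decide, rfl, rfl⟩
    · exact Submodule.subset_span ⟨[3, 3], MZV.isAdmissible_pair (by norm_num) (by norm_num), rfl, rfl⟩

/-- **`dim_ℚ 𝒵₆ ≤ 2 = d₆`**: the Goncharov–Terasoma / Deligne–Goncharov bound `dim_ℚ 𝒵_n ≤ d_n`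
(named fact `finrank_mzvSpace_le_zagierDim`) in weight `6`, unconditionally and elementarily.
Equality is open (it is the irrationality of `ζ(3)² / π⁶`). [cite: ChmutovDuzhinMostovoy2012, §10.2.6] -/
theorem finrank_mzvSpace_six_le : Module.finrank ℚ (mzvSpace 6) ≤ 2 := by
  rw [mzvSpace_six_eq_span,
    show ({Real.pi ^ 6, multipleZeta [3] ^ 2} : Set ℝ) =
      (({Real.pi ^ 6, multipleZeta [3] ^ 2} : Finset ℝ) : Set ℝ) by simp]
  exact (finrank_span_finset_le_card _).trans Finset.card_le_two

/-- `dim_ℚ 𝒵₆ ≤ d₆` (`d₆ = 2`). [cite: ChmutovDuzhinMostovoy2012, §10.2.6] -/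
theorem finrank_mzvSpace_six_le_zagierDim : Module.finrank ℚ (mzvSpace 6) ≤ zagierDim 6 :=
  finrank_mzvSpace_six_le

end Literature.NumberTheory.Transcendental
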